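import Summits.QuantumFields.YangMills.Theorems.UnitScaleTiltProp7CovLineIterGrad
import Summits.QuantumFields.YangMills.Theorems.UnitScaleTiltProp8ChartHInvGeometry
import HarnessLib

/-!
# Route `UnitScaleTilt`, crux K1 «MinimiserStabilityRegPr» (stmt-QuantumFields-19200), route-R [RP] at a curved background — THE CURVED N6,
# ROW (R-B), PART 6f: THE PURE `LINE`-TOWER AT `d = 3` — `√Σ‖S_j‖² ≤ (√L)^{−j}√Σ‖Y‖²` and
# `√Σ‖∇^{(j)}S_j‖² ≤ (√L)^j·(√Σ‖∇^{U₀}Y‖² + 154√3·ε·L²·L^j·L^{−2k}·√Σ‖Y‖²)` (the `(√L)^j` law with an `O(εL^{2−k})` mass defect)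

Cell `ym3-torus`, D-0154 (3c) R3 twin-width seat `ym-routeR-w2` (W-SEAT MAP pass #3 row M9; architecture «ℓ²-Minkowski over levels, level-local»).  The `d = 3` numerics of
✓ `Prop7CovLineIterGrad.lineIter_mass_grad_le`: `ρ_g = √(L⁴L^{−3}) = √L`, `ρ_m = √(L^{−3}L²) = (√L)^{−1}`, `κ_i ≤ 77√3·L²√L·a_i`, `a_i = 2ε(L^i/L^k)²`, and
`Σ_{i<j} ρ_g^{j−1−i}κ_iρ_m^i ≤ 154√3·ε·L²·(√L)^j·L^{−2k}·Σ_{i<j}L^i ≤ 154√3·ε·L²·(√L)^j·L^{j}·L^{−2k}` (`ChartHInv.sum_range_pow_le`).  THEOREMS ONLY (0 `def`, 0 `sorry`);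
`--supports stmt-QuantumFields-19200`, count-neutral.  YM₃ on T³ is a ladder rung (R3), not the Clay problem; nothing here claims the curved N6 bound, S2, P, the crux or the gap.

References: T. Bałaban, CMP 95 (1984) 17–40 [Balaban1984PropagatorsI] ((1.18)–(1.20) pp.19–20); CMP 98 (1985) 17–51 [Balaban1985Averaging] (Prop. 2 (53) p.26).
-/

noncomputable section

open scoped BigOperators Matrix.Norms.L2Operator

namespace Summit.QuantumFields.YangMills.Theorems.Prop7CovLineIterGradT3

open Literature.MathematicalPhysics.QuantumFieldTheory.Balaban1983to89
open Finset T4Continuum BlockAveraging AveragingRT ExpMeanLog BlockAveragingEMLLinearised BlockAveragingEMLLinearisedBackground BlockAveragingEMLProp2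
open Summit.QuantumFields.YangMills.Theorems.Prop7CovLineIterGrad (lineIter_mass_grad_le)
open Summit.QuantumFields.YangMills.Theorems.ChartHInv (sum_range_pow_le)

variable {P : Params} {n : Type*} [Fintype n] [DecidableEq n] [Nonempty n]

/-! ## §1 The `d = 3` values of the tower constants -/

omit [Fintype n] [DecidableEq n] [Nonempty n] in
/-- `ρ_m = √(L^{−3}L²) = (√L)⁻¹`. [folklore] -/
theorem rho_m_eq (hd : P.d = 3) : Real.sqrt (((P.L : ℝ) ^ P.d)⁻¹ * (P.L : ℝ) ^ 2) = (Real.sqrt P.L)⁻¹ := by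
  have hL : (0 : ℝ) < P.L := by exact_mod_cast P.L_pos
  rw [hd, show ((P.L : ℝ) ^ 3)⁻¹ * (P.L : ℝ) ^ 2 = ((P.L : ℝ))⁻¹ by field_simp, Real.sqrt_inv]

omit [Fintype n] [DecidableEq n] [Nonempty n] in
/-- `ρ_g = √(L⁴L^{−3}) = √L`. [folklore] -/
theorem rho_g_eq (hd : P.d = 3) : Real.sqrt ((P.L : ℝ) ^ 2 * (P.L : ℝ) ^ 2 * ((P.L : ℝ) ^ P.d)⁻¹) = Real.sqrt P.L := by
  have hL : (0 : ℝ) < P.L := by exact_mod_cast P.L_pos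
  rw [hd, show (P.L : ℝ) ^ 2 * (P.L : ℝ) ^ 2 * ((P.L : ℝ) ^ 3)⁻¹ = (P.L : ℝ) by field_simp]

omit [Fintype n] [DecidableEq n] [Nonempty n] in
/-- The per-level defect coefficient at `d = 3`: `κ(a) = 2L²a·√(3L) + (50L²a + 25L²a)·√(3/L) ≤ 77√3·L²·√L·a` (`a ≥ 0`). [folklore] -/
theorem kappa_le (hd : P.d = 3) {a : ℝ} (ha : 0 ≤ a) :
    2 * (P.L : ℝ) ^ 2 * a * Real.sqrt ((P.L : ℝ) ^ 2 * (P.L : ℝ) ^ 2 * ((P.L : ℝ) ^ P.d)⁻¹ * P.d)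
        + (2 * ((P.d : ℝ) + 2) ^ 2 * (P.L : ℝ) ^ 2 * a + 4 * ((((P.d + 2) * P.L : ℕ) : ℝ) ^ 2 / 4 * a))
          * Real.sqrt ((P.L : ℝ) * ((P.L : ℝ) ^ P.d)⁻¹ * (P.L : ℝ) * P.d)
      ≤ 77 * Real.sqrt 3 * (P.L : ℝ) ^ 2 * Real.sqrt P.L * a := by
  have hL : (0 : ℝ) < P.L := by exact_mod_cast P.L_pos
  have hL1 : (1 : ℝ) ≤ P.L := by exact_mod_cast P.L_pos
  have hs : 0 < Real.sqrt P.L := Real.sqrt_pos.mpr hL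
  have hs2 : Real.sqrt (P.L : ℝ) ^ 2 = P.L := Real.sq_sqrt hL.le
  have hd3 : (P.d : ℝ) = 3 := by exact_mod_cast hd
  -- the two square roots
  have h1 : Real.sqrt ((P.L : ℝ) ^ 2 * (P.L : ℝ) ^ 2 * ((P.L : ℝ) ^ P.d)⁻¹ * P.d) = Real.sqrt 3 * Real.sqrt P.L := by
    rw [hd]; push_cast
    rw [show (P.L : ℝ) ^ 2 * (P.L : ℝ) ^ 2 * ((P.L : ℝ) ^ 3)⁻¹ * 3 = 3 * (P.L : ℝ) by field_simp, Real.sqrt_mul (by norm_num)]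
  have h2 : Real.sqrt ((P.L : ℝ) * ((P.L : ℝ) ^ P.d)⁻¹ * (P.L : ℝ) * P.d) = Real.sqrt 3 * (Real.sqrt P.L)⁻¹ := by
    rw [hd]; push_cast
    rw [show (P.L : ℝ) * ((P.L : ℝ) ^ 3)⁻¹ * (P.L : ℝ) * 3 = 3 * (P.L : ℝ)⁻¹ by field_simp, Real.sqrt_mul (by norm_num), Real.sqrt_inv]
  have h3 : ((((P.d + 2) * P.L : ℕ) : ℝ) ^ 2) = 25 * (P.L : ℝ) ^ 2 := by push_cast; rw [hd3]; ring
  rw [h1, h2, h3, hd3]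
  have hs3 : 0 ≤ Real.sqrt 3 := Real.sqrt_nonneg _
  -- `L²/√L = L·√L ≤ L²·√L`
  have hkey : (P.L : ℝ) ^ 2 * (Real.sqrt P.L)⁻¹ = (P.L : ℝ) * Real.sqrt P.L := by
    field_simp
    nlinarith [hs2]
  have hineq : (P.L : ℝ) * Real.sqrt P.L ≤ (P.L : ℝ) ^ 2 * Real.sqrt P.L := by nlinarith [hs.le]
  have e : 2 * (P.L : ℝ) ^ 2 * a * (Real.sqrt 3 * Real.sqrt P.L)
        + (2 * ((3 : ℝ) + 2) ^ 2 * (P.L : ℝ) ^ 2 * a + 4 * (25 * (P.L : ℝ) ^ 2 / 4 * a)) * (Real.sqrt 3 * (Real.sqrt P.L)⁻¹)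
      = Real.sqrt 3 * a * (2 * ((P.L : ℝ) ^ 2 * Real.sqrt P.L) + 75 * ((P.L : ℝ) ^ 2 * (Real.sqrt P.L)⁻¹)) := by ring
  rw [e, hkey]
  nlinarith [mul_nonneg hs3 ha, hineq]

/-! ## §2 ★★ The pure `LINE`-tower at `d = 3` -/

/-- ★★ **THE PURE `LINE`-TOWER AT `d = 3`**: under the hypotheses of `Prop7CovLineIterGrad.lineIter_mass_grad_le` and `d = 3`, for every `j ≤ k`:
`√Σ‖S_j‖² ≤ (√L)^{−j}·√Σ‖Y‖²` and `√Σ_{b,ν}‖(∇^{(j)}_νS_j)(b)‖² ≤ (√L)^j·√Σ‖∇^{U₀}Y‖² + 154√3·ε·L²·(√L)^j·L^j·(L^k)⁻²·√Σ‖Y‖²` — since `L^j(L^k)⁻² ≤ (L^k)⁻¹`,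
the gradient energy of the pure `LINE`-iterate grows by `√L` per level up to a mass defect `O(εL²L^{−k})`, uniformly in the volume. [cite: Balaban1984PropagatorsI, (1.18)-(1.20) pp.19-20] -/
theorem lineIter_mass_grad_le_T3 (hd : P.d = 3) (U₀ : GaugeField P 0 (Matrix.specialUnitaryGroup n ℂ)) (Y : PBond P 0 → Matrix n n ℂ)
    (S : (k : ℕ) → PBond P k → Matrix n n ℂ) (hS0 : ∀ b, S 0 b = Y b)
    (hSs : ∀ (k : ℕ) (c : PBond P (k + 1)), S (k + 1) c
      = ((Fintype.card (Idx P) : ℂ))⁻¹ • ∑ i : Idx P,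
          ((holAt (Averaging.iter (fun i => blockAvg (P := P) (j := i) (expMeanLogSU (n := n))) k U₀) (walk (emb c.src) (stairWord i.2.1 (off i.1))) :
              Matrix.specialUnitaryGroup n ℂ) : Matrix n n ℂ) *
            covWalkSum (Averaging.iter (fun i => blockAvg (P := P) (j := i) (expMeanLogSU (n := n))) k U₀) (S k)
              (walk (walkEnd (emb c.src) (stairWord i.2.1 (off i.1))) (List.replicate P.L (c.dir, true))) *
          star ((holAt (Averaging.iter (fun i => blockAvg (P := P) (j := i) (expMeanLogSU (n := n))) k U₀) (walk (emb c.src) (stairWord i.2.1 (off i.1))) :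
              Matrix.specialUnitaryGroup n ℂ) : Matrix n n ℂ))
    {k : ℕ} (hk : k ≤ P.m + P.K) {ε : ℝ} (hε : 0 < ε)
    (hε3 : (143 * ((((P.d + 4 : ℕ) : ℝ)) ^ 2 / 4) ^ 2) * ε ≤ 1 / 3)
    (hε2 : 2 * ε ≤ 2 * deltaSU n / (((P.d + 4) * P.L : ℕ) : ℝ) ^ 2)
    (hU : PlaqSmall (ε * (((P.L : ℝ) ^ k)⁻¹) ^ 2) U₀) {j : ℕ} (hj : j ≤ k) :
    Real.sqrt (∑ b : PBond P j, ‖S j b‖ ^ 2) ≤ (Real.sqrt P.L)⁻¹ ^ j * Real.sqrt (∑ b : PBond P 0, ‖Y b‖ ^ 2)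
      ∧ Real.sqrt (∑ b : PBond P j, ∑ ν : Fin P.d,
            ‖((Averaging.iter (fun i => blockAvg (P := P) (j := i) (expMeanLogSU (n := n))) j U₀ ⟨b.src, ν⟩ : Matrix.specialUnitaryGroup n ℂ) : Matrix n n ℂ)
                * S j ⟨b.src.shift ν, b.dir⟩
                * star ((Averaging.iter (fun i => blockAvg (P := P) (j := i) (expMeanLogSU (n := n))) j U₀ ⟨b.src, ν⟩ : Matrix.specialUnitaryGroup n ℂ) : Matrix n n ℂ)
              - S j b‖ ^ 2)
          ≤ Real.sqrt P.L ^ j * Real.sqrt (∑ b : PBond P 0, ∑ ν : Fin P.d,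
                ‖((U₀ ⟨b.src, ν⟩ : Matrix.specialUnitaryGroup n ℂ) : Matrix n n ℂ) * Y ⟨b.src.shift ν, b.dir⟩
                    * star ((U₀ ⟨b.src, ν⟩ : Matrix.specialUnitaryGroup n ℂ) : Matrix n n ℂ) - Y b‖ ^ 2)
            + 154 * Real.sqrt 3 * ε * (P.L : ℝ) ^ 2 * Real.sqrt P.L ^ j * ((P.L : ℝ) ^ j * (((P.L : ℝ) ^ k)⁻¹) ^ 2)
              * Real.sqrt (∑ b : PBond P 0, ‖Y b‖ ^ 2) := by
  have hL : (0 : ℝ) < P.L := by exact_mod_cast P.L_pos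
  have hs : 0 < Real.sqrt P.L := Real.sqrt_pos.mpr hL
  have hs2 : Real.sqrt (P.L : ℝ) ^ 2 = P.L := Real.sq_sqrt hL.le
  have hLk : (0 : ℝ) < (P.L : ℝ) ^ k := pow_pos hL _
  obtain ⟨hm, hg⟩ := lineIter_mass_grad_le U₀ Y S hS0 hSs hk hε hε3 hε2 hU j hj
  rw [rho_m_eq hd] at hm hg
  rw [rho_g_eq hd] at hg
  refine ⟨hm, hg.trans (add_le_add le_rfl (mul_le_mul_of_nonneg_right ?_ (Real.sqrt_nonneg _)))⟩
  -- the sum of the per-level defects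
  set M2 : ℝ := ((P.L : ℝ) ^ k)⁻¹ with hM2
  have hterm : ∀ i ∈ range j,
      Real.sqrt P.L ^ (j - 1 - i)
          * ((2 * (P.L : ℝ) ^ 2 * (2 * ε * ((P.L : ℝ) ^ i * ((P.L : ℝ) ^ k)⁻¹) ^ 2) * Real.sqrt ((P.L : ℝ) ^ 2 * (P.L : ℝ) ^ 2 * ((P.L : ℝ) ^ P.d)⁻¹ * P.d)
              + (2 * ((P.d : ℝ) + 2) ^ 2 * (P.L : ℝ) ^ 2 * (2 * ε * ((P.L : ℝ) ^ i * ((P.L : ℝ) ^ k)⁻¹) ^ 2)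
                  + 4 * ((((P.d + 2) * P.L : ℕ) : ℝ) ^ 2 / 4 * (2 * ε * ((P.L : ℝ) ^ i * ((P.L : ℝ) ^ k)⁻¹) ^ 2)))
                * Real.sqrt ((P.L : ℝ) * ((P.L : ℝ) ^ P.d)⁻¹ * (P.L : ℝ) * P.d)))
          * (Real.sqrt P.L)⁻¹ ^ i
        ≤ 154 * Real.sqrt 3 * ε * (P.L : ℝ) ^ 2 * Real.sqrt P.L ^ j * (((P.L : ℝ) ^ k)⁻¹) ^ 2 * (P.L : ℝ) ^ i := by
    intro i hi
    have hij : i < j := Finset.mem_range.mp hi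
    have ha : 0 ≤ 2 * ε * ((P.L : ℝ) ^ i * ((P.L : ℝ) ^ k)⁻¹) ^ 2 := by positivity
    have hκ := kappa_le (P := P) hd ha
    have hp0 : 0 ≤ Real.sqrt P.L ^ (j - 1 - i) := pow_nonneg hs.le _
    have hq0 : 0 ≤ (Real.sqrt P.L)⁻¹ ^ i := pow_nonneg (inv_nonneg.mpr hs.le) _
    calc _ ≤ Real.sqrt P.L ^ (j - 1 - i) * (77 * Real.sqrt 3 * (P.L : ℝ) ^ 2 * Real.sqrt P.L * (2 * ε * ((P.L : ℝ) ^ i * ((P.L : ℝ) ^ k)⁻¹) ^ 2))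
            * (Real.sqrt P.L)⁻¹ ^ i := mul_le_mul_of_nonneg_right (mul_le_mul_of_nonneg_left hκ hp0) hq0
      _ = 154 * Real.sqrt 3 * ε * (P.L : ℝ) ^ 2 * Real.sqrt P.L ^ j * (((P.L : ℝ) ^ k)⁻¹) ^ 2 * (P.L : ℝ) ^ i := by
          -- `(√L)^{j-1-i}·√L·(√L)^{-i}·L^{2i} = (√L)^j·L^i`
          have hpow : Real.sqrt P.L ^ (j - 1 - i) * Real.sqrt P.L * (Real.sqrt P.L)⁻¹ ^ i * ((P.L : ℝ) ^ i) ^ 2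
              = Real.sqrt P.L ^ j * (P.L : ℝ) ^ i := by
            have e1 : Real.sqrt P.L ^ (j - 1 - i) * Real.sqrt P.L = Real.sqrt P.L ^ (j - i) := by
              rw [← pow_succ]; congr 1; omega
            have e2 : ((P.L : ℝ) ^ i) = Real.sqrt P.L ^ (2 * i) := by rw [pow_mul, hs2]
            have e3 : Real.sqrt P.L ^ j = Real.sqrt P.L ^ (j - i) * Real.sqrt P.L ^ i := by rw [← pow_add]; congr 1; omega
            rw [e1, e2, e3, inv_pow]
            field_simp
            ring
          calc _ = 154 * Real.sqrt 3 * ε * (P.L : ℝ) ^ 2 * (((P.L : ℝ) ^ k)⁻¹) ^ 2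
                * (Real.sqrt P.L ^ (j - 1 - i) * Real.sqrt P.L * (Real.sqrt P.L)⁻¹ ^ i * ((P.L : ℝ) ^ i) ^ 2) := by ring
            _ = _ := by rw [hpow]; ring
  calc ∑ i ∈ range j, Real.sqrt P.L ^ (j - 1 - i)
          * ((2 * (P.L : ℝ) ^ 2 * (2 * ε * ((P.L : ℝ) ^ i * ((P.L : ℝ) ^ k)⁻¹) ^ 2) * Real.sqrt ((P.L : ℝ) ^ 2 * (P.L : ℝ) ^ 2 * ((P.L : ℝ) ^ P.d)⁻¹ * P.d)
              + (2 * ((P.d : ℝ) + 2) ^ 2 * (P.L : ℝ) ^ 2 * (2 * ε * ((P.L : ℝ) ^ i * ((P.L : ℝ) ^ k)⁻¹) ^ 2)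
                  + 4 * ((((P.d + 2) * P.L : ℕ) : ℝ) ^ 2 / 4 * (2 * ε * ((P.L : ℝ) ^ i * ((P.L : ℝ) ^ k)⁻¹) ^ 2)))
                * Real.sqrt ((P.L : ℝ) * ((P.L : ℝ) ^ P.d)⁻¹ * (P.L : ℝ) * P.d)))
          * (Real.sqrt P.L)⁻¹ ^ i
      ≤ ∑ i ∈ range j, 154 * Real.sqrt 3 * ε * (P.L : ℝ) ^ 2 * Real.sqrt P.L ^ j * (((P.L : ℝ) ^ k)⁻¹) ^ 2 * (P.L : ℝ) ^ i := Finset.sum_le_sum hterm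
    _ = 154 * Real.sqrt 3 * ε * (P.L : ℝ) ^ 2 * Real.sqrt P.L ^ j * (((P.L : ℝ) ^ k)⁻¹) ^ 2 * ∑ i ∈ range j, (P.L : ℝ) ^ i := by rw [Finset.mul_sum]
    _ ≤ 154 * Real.sqrt 3 * ε * (P.L : ℝ) ^ 2 * Real.sqrt P.L ^ j * (((P.L : ℝ) ^ k)⁻¹) ^ 2 * (P.L : ℝ) ^ j :=
        mul_le_mul_of_nonneg_left (sum_range_pow_le (P := P) j) (by positivity)
    _ = 154 * Real.sqrt 3 * ε * (P.L : ℝ) ^ 2 * Real.sqrt P.L ^ j * ((P.L : ℝ) ^ j * (((P.L : ℝ) ^ k)⁻¹) ^ 2) := by ring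

end Summit.QuantumFields.YangMills.Theorems.Prop7CovLineIterGradT3

end
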